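import Mathlib
import HarnessLib
import Summits.Ventures.LatticeQCDFlow.Exactness.LazyLayers
import Summits.Ventures.LatticeQCDFlow.Exactness.QuasiStaticFloorLaw
import Summits.Ventures.LatticeQCDFlow.Scaling.PerfectRelaxationMonotone

/-!
# Lazy (under-relaxed) layers never beat the perfect-relaxation ESS ceiling

HONEST FRAMING: exact (Metropolis-corrected) sampling algorithms for lattice gauge theory;
figures of merit are autocorrelation/cost numbers at stated couplings and volumes; no
continuum-physics claim.

Venture `LatticeQCDFlow` (cell pub-lqcd), topic `Exactness`, FANOUT row 8 (s0-cpn-nemc, GEN-5).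
OUR WORK (a composition of tree theorems), nothing cited as a fact.  The ESS companion of the lag
law (`Exactness/LazyRelaxationLagLaw.lean`: with lazy perfect-relaxation layers
`ε·I + (1 − ε)·Π` the printed `D̃_KL = ⟨W⟩ − ΔF` EXCEEDS the quasi-static floor by an explicit
non-negative lag term).  On the reweighting side the theory seat's (C3″)
`Theory2.perfectRelaxation_dominates_monotone` (perfect relaxation maximises the NE-MCMC / SNF path
ESS among layers that preserve the cone of functions antitone in the order parameter) applies
verbatim, because the lazy layer is such a layer (`Theory2.monotone_layer_lazy`) and leaves the
Boltzmann weight invariant (`isStationary_lazyLayer_gibbs`):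

* `lazyLayer_monotone` — the lazy layer maps `A`-antitone functions to `A`-antitone functions, in
  the binder format of (C3″);
* **`ess_lazy_le_prod`** — for the linear protocol `S_{c_k} = S₀ + c_k • D` along ANY monotone grid
  and any laziness `0 ≤ ε < 1`, the path ESS with lazy layers is at most the perfect-relaxation
  value `Π_k ESS(π_{c_{k+1}}, π_{c_k})` (order parameter `A := D`: the increments
  `(c_{k+1} − c_k) D` are non-decreasing in `D`);
* **`ess_lazy_uniform_le_exp`** — hence row 8's CERTIFIED ESS CEILING of
  `QuasiStaticFloorLaw.ess_perfect_uniform_le_exp` holds for every laziness: along the uniform grid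
  `c_k = k/n` with `|κ₃,c(D)| ≤ M` on `[0, 1]`,
  `ÊSS_lazy ≤ exp(−(⟨D⟩_0 − ⟨D⟩_1)/(2n) + M/(12 n²))`.

Reading (HOME/s0-cpn-nemc/RESULTS.md §7(c), §9, §12; OURS): under-relaxation moves BOTH printed
figures of merit the costly way — `D̃_KL` up (lag law, exactly) and `ÊSS` down (this file, as a
bound) — so neither the floor `12.35 · L_d / n_step` nor the ceiling derived from it at
(N, β, L) = (21, 0.7, 114) can be crossed by relaxing LESS; the S0-D2 reproduction's 15 composite
cells (6–29 % above the floor, 1–8 % under the Gaussian ceiling) sit on the allowed side of both.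
Only the lazy class is covered; the production heat-bath / over-relaxation kernels are not claimed
to be `D`-monotone.
-/

namespace Summit.Ventures.LatticeQCDFlow.Exactness

open Finset Set
open Literature.Probability.MarkovChains (IsStationary)
open Summit.Ventures.LatticeQCDFlow.Theory2

variable {X : Type*} [Fintype X] [DecidableEq X]

/-- The lazy layer onto any law `p` maps `A`-antitone functions to `A`-antitone functions
(`Theory2.monotone_layer_lazy`, restated for `lazyLayer` in the binder format of (C3″)). -/
theorem lazyLayer_monotone (A p : X → ℝ) {ε : ℝ} (hε : 0 ≤ ε) (f : X → ℝ)
    (hf : ∀ x y, A x ≤ A y → f y ≤ f x) (x y : X) (hxy : A x ≤ A y) :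
    ∑ z, lazyLayer p ε y z * f z ≤ ∑ z, lazyLayer p ε x z * f z :=
  monotone_layer_lazy A p hε f hf x y hxy

/-- **Lazy layers never beat perfect relaxation's ESS.**  For the linear protocol along a monotone
grid `c` and any laziness `0 ≤ ε < 1`, the NE-MCMC / SNF reweighting ESS of the path law with lazy
perfect-relaxation layers is at most the perfect-relaxation product `Π_k ESS(π_{c_{k+1}}, π_{c_k})`
((C3″) with order parameter `D`). -/
theorem ess_lazy_le_prod [Nonempty X] (S₀ D : X → ℝ) {c : ℕ → ℝ} (hc : Monotone c) {ε : ℝ}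
    (h0 : 0 ≤ ε) (h1 : ε < 1) (n : ℕ) :
    essFrac (revPathLaw (fun k : Fin (n + 1) => linAction S₀ D (c k))
              (fun k : Fin n => lazyLayer (gibbsLaw (linAction S₀ D (c (k + 1)))) ε))
            (pathLaw (gibbsLaw (linAction S₀ D (c 0)))
              (fun k : Fin n => lazyLayer (gibbsLaw (linAction S₀ D (c (k + 1)))) ε))
      ≤ ∏ k : Fin n, essFrac (gibbsLaw (linAction S₀ D (c (k + 1))))
          (gibbsLaw (linAction S₀ D (c k))) := by
  have h := perfectRelaxation_dominates_monotone D (fun k : Fin (n + 1) => linAction S₀ D (c k))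
    (fun k : Fin n => lazyLayer (gibbsLaw (linAction S₀ D (c (k + 1)))) ε)
    (fun k x y hxy => by
      simp only [linAction, Fin.val_succ, Fin.val_castSucc]
      have hk : c k ≤ c (k + 1) := hc (Nat.le_succ _)
      nlinarith [mul_nonneg (sub_nonneg.mpr hk) (sub_nonneg.mpr hxy)])
    (fun k x y => lazyLayer_pos (gibbsLaw_pos _) h0 h1 x y)
    (fun k => by
      simpa only [Fin.val_succ] using
        isStationary_lazyLayer_gibbs (linAction S₀ D (c (k + 1))) ε)
    (fun k f hf x y hxy => lazyLayer_monotone D _ h0 f hf x y hxy)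
  simpa only [Fin.val_succ, Fin.val_castSucc, Fin.val_zero] using h

/-- **The certified ESS ceiling survives under-relaxation.**  Along the uniform grid `c_k = k/n`
(Bonanno–Nada–Vadacchino's `c(n) = n/n_step`), with `|κ₃,c(D)| ≤ M` on `[0, 1]` and any laziness
`0 ≤ ε < 1`: `ÊSS_lazy ≤ exp(−(⟨D⟩_0 − ⟨D⟩_1)/(2n) + M/(12 n²))` — the perfect-relaxation ceiling of
`ess_perfect_uniform_le_exp` (T2-W with the reverse floor law), now for the whole lazy class. -/
theorem ess_lazy_uniform_le_exp [Nonempty X] (S₀ D : X → ℝ) {ε : ℝ} (h0 : 0 ≤ ε) (h1 : ε < 1)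
    {n : ℕ} (hn : n ≠ 0) {M : ℝ} (hM : ∀ c ∈ Icc (0:ℝ) 1, |kappa3D S₀ D c| ≤ M) :
    essFrac (revPathLaw (fun k : Fin (n + 1) => linAction S₀ D ((k : ℕ) / (n : ℝ)))
              (fun k : Fin n => lazyLayer (gibbsLaw (linAction S₀ D (((k + 1 : ℕ) : ℝ) / n))) ε))
            (pathLaw (gibbsLaw (linAction S₀ D ((0 : ℕ) / (n : ℝ))))
              (fun k : Fin n => lazyLayer (gibbsLaw (linAction S₀ D (((k + 1 : ℕ) : ℝ) / n))) ε))
      ≤ Real.exp (-((meanD S₀ D 0 - meanD S₀ D 1) / (2 * n)) + M / (12 * (n : ℝ) ^ 2)) := by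
  have hmono : Monotone (fun k : ℕ => (k : ℝ) / n) :=
    fun _ _ hab => div_le_div_of_nonneg_right (Nat.cast_le.mpr hab) (Nat.cast_nonneg n)
  have h1' := ess_lazy_le_prod S₀ D hmono h0 h1 n
  beta_reduce at h1'
  have h2 := ess_perfect_relaxation (fun k : Fin (n + 1) => linAction S₀ D ((k : ℕ) / (n : ℝ)))
  simp only [Fin.val_succ, Fin.val_castSucc, Fin.val_zero] at h2
  have h3 := ess_perfect_uniform_le_exp S₀ D hn hM
  rw [h2] at h3
  exact h1'.trans h3

end Summit.Ventures.LatticeQCDFlow.Exactness
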